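import Summits.BirchSwinnertonDyer.BirchSwinnertonDyer.Theorems.SignedLowerHalvesSmallImageLowerHalfBothSignsRttD2SeqSemilocKernel
import HarnessLib

/-!
# Route `SignedLowerHalves`, crux L `SmallImageLowerHalfBothSigns` (stmt-BirchSwinnertonDyer-23599), line `rtt_w3` v26 — stub S3β (`stub_junctionPT_ns`, row J4′,
# Poitou–Tate half), brick T5: THE λ-ASSEMBLY OF THE POITOU–TATE HALF —
# `λ(H′) ≤ λ(Y) + λ(I.H ⧸ B′)` for every `Λ_𝒪`-submodule `H′` of the semilocal Iwasawa module `Π_{w∈S₀} 𝐇¹_{Iw,w}` and every `Λ`-linear `Φ : H′ → Y` whose kernel consists of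
# semilocalisations of junction classes

WIDTH seat `bsd-line-slh-p3-w3` g25 under LEAD `cruxlead-stmt-BirchSwinnertonDyer-23599` g13 (cell `bsd-ssimc`); helper `--supports stmt-BirchSwinnertonDyer-23599`
(design memo `Lines/rtt_w3-DESIGN-S3beta-w3-g25.md`, §1 chain (c)+(d)+(e)). PURE THEOREMS (λ-bookkeeping over the tree's `lambdaInvariant` API); no definition, no named fact,
no instance, no `sorry`. HONEST FRAMING: this is the algebraic skeleton of S3β″ «`λ(Λ_𝒪/(E)) ≤ λ(Y″) + λ(I.H ⧸ B′)`»: with `H′ :=` the `(S₀K ∖ P)`-unramified semilocal classes,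
`Y := Y″ = (Sel_{str,v} ⧸ Sel_str)^∨` (lambda-p1 `locImageQuot`/`locImageDualModule`, p809903) and `Φ :=` the semilocal tower pairing against `Sel_{str,v}` (brick N2, OPEN), the
kernel hypothesis `hPT` is EXACTLY the output of T4 (`exists_forall_semilocMap_eq_of_forall_orth`, p812108) once `ker Φ ⊆ {levelwise orthogonal}`; what then remains of S3β″ is the
local count `λ(Λ_𝒪/(E)) ≤ λ(H′)` (N5). Nothing about S3β, E2, crux L or BSD is proved here; all remain OPEN and are proved for NO curve.

WHAT. ★★★ `lambdaInvariant_le_add_of_ker_subset_range_semilocMapPi`: for honda's `I`, the semilocal data `L w` (T1-b₂), `B′ = strictCarrier I (strictLevel … S₀)` and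
`sloc_{S₀} = semilocMapPi` (T2′, `ker sloc_{S₀} = B′`): if `Π_{w∈S₀} (L w).H` is finitely generated torsion over `Λ`, `H′ ≤ Π` is a `Λ_𝒪`-submodule, `Y` a finitely generated torsion
`Λ`-module and `Φ : H′ →ₗ[Λ] Y` has `ker Φ ⊆ range sloc_{S₀}`, then `λ(H′) ≤ λ(Y) + λ(I.H ⧸ range B′.subtype)`. Proof: `λ(H′) = λ(ker Φ) + λ(range Φ)` (additivity along
`Φ.rangeRestrict`), `λ(range Φ) ≤ λ(Y)` (injection), `ker Φ ↪ range sloc_{S₀} ≅ I.H ⧸ ker sloc_{S₀} = I.H ⧸ B′` (injection + first isomorphism theorem).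
References: [Washington1997] §13.2; [Rubin2000] Thm. 1.7.3, App. B.3; [Kobayashi2003] Thm. 7.3 i); [PerrinRiou1994Invent] §1.3; [GreenbergVatsal2000] §2 Prop. (2.4).
-/

set_option autoImplicit false
set_option linter.dupNamespace false -- D-0017: single-problem summit, the namespace repeats the problem name by design
noncomputable section

open scoped Classical
open NumberField IsDedekindDomain Field Function

namespace Summit.BirchSwinnertonDyer.BirchSwinnertonDyer.Theorems.SmallImageRttD2Seq

open Literature.NumberTheory.EllipticCurves Literature.NumberTheory.EllipticCurves.IwasawaDual Literature.NumberTheory.GaloisRepresentations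
  Literature.NumberTheory.ComplexMultiplication.EllipticUnits Literature.NumberTheory.ComplexMultiplication.EllipticUnits.JohnsonLeungKings2011
  Summit.BirchSwinnertonDyer.BirchSwinnertonDyer.Theorems.SmallImageRttD2J1
open Summit.BirchSwinnertonDyer.Rank1Residual.X2.DualRestrictionInvariants (lambdaInvariant_eq_add_of_surjective)

section Assembly

variable {K : Type} [Field K] [NumberField K] {p : ℕ} [Fact p.Prime] {S : Set (PadicAlgCl p)} {κ : ZpExtension K p} {γ : absoluteGaloisGroup K}
  {θ' : absoluteGaloisGroup K →ₜ* (padicCoeffIntegers S)ˣ} {P : Set (HeightOneSpectrum (𝓞 K))}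
  (hNP : ∀ n, ramificationSubgroup K P ≤ κ.layerSubgroup n) (S₀ : Set (HeightOneSpectrum (𝓞 K)))
  (I : CycIwasawaCohomologyDataO S κ γ θ' P 1) (L : ∀ w : HeightOneSpectrum (𝓞 K), SemilocIwasawaCohomologyDataO S κ γ θ' P w 1)
  (hStr : ∀ (n k : ℕ) (f : IwasawaAlgebraO S) (y : cycLayerCohO S κ θ' P n k 1), y ∈ strictLevel S κ θ' P S₀ n k →
    (letI := cycLayerModuleO S κ γ θ' P (show 1 ≤ 2 by norm_num) n k; f • y) ∈ strictLevel S κ θ' P S₀ n k)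

/-- Submodules of torsion modules are torsion (for the restricted-scalar `Λ`-structure of a `Λ_𝒪`-submodule). [folklore] -/
theorem isTorsion_submodule_of_isTorsion {R : Type*} [CommRing R] {A : Type*} [CommRing A] [Algebra R A] {X : Type*} [AddCommGroup X] [Module A X] [Module R X]
    [IsScalarTower R A X] (N : Submodule A X) (hX : Module.IsTorsion R X) : Module.IsTorsion R N := by
  intro x
  obtain ⟨a, ha⟩ := @hX (x : X)
  refine ⟨a, Subtype.ext ?_⟩
  exact ha

/-- `Λ`-submodules of torsion `Λ`-modules are torsion. [folklore] -/
theorem isTorsion_submodule_of_isTorsion' {R : Type*} [CommRing R] {X : Type*} [AddCommGroup X] [Module R X] (N : Submodule R X) (hX : Module.IsTorsion R X) :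
    Module.IsTorsion R N := by
  intro x
  obtain ⟨a, ha⟩ := @hX (x : X)
  refine ⟨a, Subtype.ext ?_⟩
  exact ha

set_option maxHeartbeats 400000 in
/-- ★★★ **THE λ-ASSEMBLY OF THE POITOU–TATE HALF (S3β″ modulo N2 and N5).** Let `Π = Π_{w∈S₀} 𝐇¹_{Iw,w}` (the semilocal Iwasawa modules `L w`, T1-b₂) be finitely generated torsion
over `Λ`, `H′ ≤ Π` a `Λ_𝒪`-submodule (intended: the classes unramified at the places of `S₀ ∖ P` at every level), `Y` a finitely generated torsion `Λ`-module (intended: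
`Y″ = (Sel_{str,v} ⧸ Sel_str)^∨`) and `Φ : H′ →ₗ[Λ] Y` (intended: the semilocal tower pairing against `Sel_{str,v}`) such that EVERY `h ∈ ker Φ` IS A SEMILOCALISATION: `h = sloc_{S₀} b`,
`b ∈ I.H` (the output of T4 `exists_forall_semilocMap_eq_of_forall_orth`). Then `λ(H′) ≤ λ(Y) + λ(I.H ⧸ range B′.subtype)` with `B′ = strictCarrier I (strictLevel … S₀) = ker sloc_{S₀}`
(T2′): `λ(H′) = λ(ker Φ) + λ(range Φ)`, `range Φ ↪ Y`, `ker Φ ↪ range sloc_{S₀} ≅ I.H ⧸ B′`. [cite: Washington1997, §13.2] [cite: Rubin2000, Thm. 1.7.3, App. B.3]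
[cite: Kobayashi2003, Thm. 7.3 i)] [cite: PerrinRiou1994Invent, §1.3] -/
theorem lambdaInvariant_le_add_of_ker_subset_range_semilocMapPi
    (hfin : letI : ∀ w : HeightOneSpectrum (𝓞 K), Module (IwasawaAlgebra p) (L w).H := fun w ↦ (L w).moduleIwasawa
      Module.Finite (IwasawaAlgebra p) (∀ w : S₀, (L w).H))
    (htors : letI : ∀ w : HeightOneSpectrum (𝓞 K), Module (IwasawaAlgebra p) (L w).H := fun w ↦ (L w).moduleIwasawa
      Module.IsTorsion (IwasawaAlgebra p) (∀ w : S₀, (L w).H))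
    (H' : Submodule (IwasawaAlgebraO S) (∀ w : S₀, (L w).H))
    {Y : Type*} [AddCommGroup Y] [Module (IwasawaAlgebra p) Y] [Module.Finite (IwasawaAlgebra p) Y] (hY : Module.IsTorsion (IwasawaAlgebra p) Y)
    (Φ : letI : ∀ w : HeightOneSpectrum (𝓞 K), Module (IwasawaAlgebra p) (L w).H := fun w ↦ (L w).moduleIwasawa
      letI : Algebra (IwasawaAlgebra p) (IwasawaAlgebraO S) := (iwasawaToIwasawaO S).toAlgebra
      haveI : ∀ w : HeightOneSpectrum (𝓞 K), IsScalarTower (IwasawaAlgebra p) (IwasawaAlgebraO S) (L w).H := fun w ↦ (L w).isScalarTower_moduleIwasawa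
      H' →ₗ[IwasawaAlgebra p] Y)
    (hPT : ∀ x : H', Φ x = 0 → (x : ∀ w : S₀, (L w).H) ∈ LinearMap.range (semilocMapPi hNP S₀ I L)) :
    letI := I.moduleIwasawa
    letI : Algebra (IwasawaAlgebra p) (IwasawaAlgebraO S) := (iwasawaToIwasawaO S).toAlgebra
    haveI := I.isScalarTower_moduleIwasawa
    letI : ∀ w : HeightOneSpectrum (𝓞 K), Module (IwasawaAlgebra p) (L w).H := fun w ↦ (L w).moduleIwasawa
    haveI : ∀ w : HeightOneSpectrum (𝓞 K), IsScalarTower (IwasawaAlgebra p) (IwasawaAlgebraO S) (L w).H := fun w ↦ (L w).isScalarTower_moduleIwasawa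
    lambdaInvariant p H' ≤ lambdaInvariant p Y + lambdaInvariant p (I.H ⧸ LinearMap.range (Submodule.subtype (strictCarrier I (strictLevel S κ θ' P S₀) hStr))) := by
  letI := I.moduleIwasawa
  letI : Algebra (IwasawaAlgebra p) (IwasawaAlgebraO S) := (iwasawaToIwasawaO S).toAlgebra
  haveI := I.isScalarTower_moduleIwasawa
  letI : ∀ w : HeightOneSpectrum (𝓞 K), Module (IwasawaAlgebra p) (L w).H := fun w ↦ (L w).moduleIwasawa
  haveI : ∀ w : HeightOneSpectrum (𝓞 K), IsScalarTower (IwasawaAlgebra p) (IwasawaAlgebraO S) (L w).H := fun w ↦ (L w).isScalarTower_moduleIwasawa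
  haveI := hfin
  haveI : IsNoetherian (IwasawaAlgebra p) (∀ w : S₀, (L w).H) := isNoetherian_of_isNoetherianRing_of_finite _ _
  -- the `Λ`-restricted semilocalisation and its range
  set σ : I.H →ₗ[IwasawaAlgebra p] (∀ w : S₀, (L w).H) := (semilocMapPi hNP S₀ I L).restrictScalars (IwasawaAlgebra p) with hσ
  have hkerσ : LinearMap.ker σ = (strictCarrier I (strictLevel S κ θ' P S₀) hStr).restrictScalars (IwasawaAlgebra p) := by
    rw [hσ, LinearMap.ker_restrictScalars, ker_semilocMapPi hNP S₀ I L hStr]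
  -- finiteness / torsion of the players
  haveI : Module.Finite (IwasawaAlgebra p) H' :=
    Module.Finite.of_injective (H'.subtype.restrictScalars (IwasawaAlgebra p)) (Submodule.subtype_injective _)
  have htorsH' : Module.IsTorsion (IwasawaAlgebra p) H' := isTorsion_submodule_of_isTorsion H' htors
  haveI : Module.Finite (IwasawaAlgebra p) (LinearMap.range σ) :=
    Module.Finite.of_injective (LinearMap.range σ).subtype (Submodule.subtype_injective _)
  have htorsR : Module.IsTorsion (IwasawaAlgebra p) (LinearMap.range σ) := isTorsion_submodule_of_isTorsion' _ htors
  -- (1) additivity along `Φ.rangeRestrict`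
  have h1 := lambdaInvariant_eq_add_of_surjective p Φ.rangeRestrict htorsH' (LinearMap.surjective_rangeRestrict Φ)
  rw [LinearMap.ker_rangeRestrict] at h1
  -- (2) `range Φ ↪ Y`
  have h2 : lambdaInvariant p (LinearMap.range Φ) ≤ lambdaInvariant p Y :=
    SmallImageRttCharRoad.lambdaInvariant_le_of_injective_of_isTorsion (LinearMap.range Φ).subtype (Submodule.subtype_injective _) hY
  -- (3) `ker Φ ↪ range σ`
  have hmem : ∀ x : LinearMap.ker Φ, ((x : H') : ∀ w : S₀, (L w).H) ∈ LinearMap.range σ := fun x ↦ by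
    obtain ⟨b, hb⟩ := hPT x.1 x.2
    exact ⟨b, hb⟩
  let ψ : LinearMap.ker Φ →ₗ[IwasawaAlgebra p] LinearMap.range σ :=
    LinearMap.codRestrict (LinearMap.range σ) ((H'.subtype.restrictScalars (IwasawaAlgebra p)).comp (LinearMap.ker Φ).subtype) hmem
  have hψ : Injective ψ := by
    intro x y h
    have h' := congrArg Subtype.val h
    exact Subtype.ext (Subtype.ext h')
  have h3 : lambdaInvariant p (LinearMap.ker Φ) ≤ lambdaInvariant p (LinearMap.range σ) :=
    SmallImageRttCharRoad.lambdaInvariant_le_of_injective_of_isTorsion ψ hψ htorsR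
  -- (4) `range σ ≅ I.H ⧸ ker σ = I.H ⧸ B′ = I.H ⧸ range B′.subtype`
  have e1 : (I.H ⧸ LinearMap.ker σ) ≃ₗ[IwasawaAlgebra p] LinearMap.range σ := σ.quotKerEquivRange
  have e2 : (I.H ⧸ LinearMap.ker σ) ≃ₗ[IwasawaAlgebra p] (I.H ⧸ strictCarrier I (strictLevel S κ θ' P S₀) hStr) :=
    (Submodule.quotEquivOfEq _ _ hkerσ).trans (Submodule.Quotient.restrictScalarsEquiv (IwasawaAlgebra p) _)
  have e3 : (I.H ⧸ LinearMap.range (Submodule.subtype (strictCarrier I (strictLevel S κ θ' P S₀) hStr))) ≃ₗ[IwasawaAlgebraO S]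
      (I.H ⧸ strictCarrier I (strictLevel S κ θ' P S₀) hStr) := Submodule.quotEquivOfEq _ _ (Submodule.range_subtype _)
  have h4 : lambdaInvariant p (LinearMap.range σ) =
      lambdaInvariant p (I.H ⧸ LinearMap.range (Submodule.subtype (strictCarrier I (strictLevel S κ θ' P S₀) hStr))) := by
    rw [← lambdaInvariant_eq_of_linearEquiv e1, lambdaInvariant_eq_of_linearEquiv e2,
      lambdaInvariant_eq_of_linearEquiv (e3.restrictScalars (IwasawaAlgebra p))]
  omega

end Assembly

end Summit.BirchSwinnertonDyer.BirchSwinnertonDyer.Theorems.SmallImageRttD2Seq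

end
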